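import Literature.AlgebraicGeometry.Motives.AbelianVarietyPointDerivations
import HarnessLib

/-!
# Translating tangent vectors of an abelian variety to an arbitrary point: additivity and homogeneity

Topic `Literature/AlgebraicGeometry/Motives`, namespace
`Literature.AlgebraicGeometry.Motives.AbelianVariety`. Theorems and auxiliary definitions (no named
fact; net Literature debt 0). Second file of route D′ towards `Mumford1970_cotangentSheaf_abelianVariety_free`
(Görtz–Wedhorn II Prop. 27.15). For an `L`-point `ξ` of `A` based at `x` (`L ⊇ K` a field) and an
`L`-valued tangent vector `t` at the origin (`t ∈ tangentL A L = Ker(A(L[ε]) → A(L))`), the TRANSLATE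
`ξ₀ · t` (product in the group `A(L[ε])`, `ξ₀` the constant lift of `ξ`) is an `L[ε]`-point over `ξ`; its
point derivation `translatedDerivation x ξ hξ t : 𝒪_{A,x} →+ L` is the value at `ξ` of the left-invariant
vector field of `t` (Görtz–Wedhorn II, Rem. 27.1: left translation on `T`-valued points). This file proves
that `t ↦ ∂_{ξ₀·t}` is injective, additive and `L`-homogeneous:

* `tangentL A L`, `mem_tangentL_iff`, `aug_comp_liftPt_mul`, `translatedDerivation`;
* **`translatedDerivation_eq_zero_iff`** — `∂_{ξ₀·t} = 0 ↔ t = 1`: CANCELLATION in `A(L[ε])` plus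
  `eq_liftPt_of_pointDerivation_eq_zero` (this replaces «translations act transitively»: the translation
  by the non-rational point `x` is left multiplication by `ξ₀`, no morphism `A → A` needed);
* `scaleEps K c` (`a + bε ↦ a + cbε`), **`translatedDerivation_scale`** — `∂_{ξ₀·(c·t)} = c ∂_{ξ₀·t}`
  (Görtz–Wedhorn II, Rem. 27.18 (4): `ε ↦ cε` induces the scalar multiplication on `Lie`);
* **`translatedDerivation_mul`** — `∂_{ξ₀·t₁t₂} = ∂_{ξ₀·t₁} + ∂_{ξ₀·t₂}`: the `L[ε₁, ε₂]`-argument of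
  Görtz–Wedhorn II, Rem. 27.18 (3) (`T_e(m) = +`; the tree's `snd_evAt_mul`) transported from `e` to `x`
  and from `K` to `L`, using the `L[ε₁,ε₂]`-point `u = ξ₀₀ · incl₁^* t₁ · incl₂^* t₂`;
* `translatedDerivation_prod_scale` — `∂_{ξ₀·∏(g i)·t i} = ∑ g i ∂_{ξ₀·t i}`.

Presearch: [corpus: book:gortz2023 p. 806 Rem. 27.18 (3)–(4)] gives `T_e(m) = +` and the scalar
multiplication at the ORIGIN over the base; the translated form at a non-rational point is not in print
as such (GW II Prop. 27.15 p. 805 uses the cartesian square `(m, p₁)` on `G × G` instead); `lit search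
--hybrid` / `vsearch`: GW II pp. 805–806, Bosch AGCA p. 409; galaxy «invariant derivations|invariant
differential forms|Lie algebra of a group scheme»: no usable hit. Mathlib searched and used:
`TrivSqZeroExt.map`/`map_inl`/`snd_map`/`fst_map`, `MonObj.comp_mul`/`comp_one`, the scoped
`Hom.commGroup`, `prod_mem`, `Finset.prod_insert`; in this tree: `DualNumber₂` with
`proj₁/proj₂/incl₁/incl₂/codiag/aug`, their composition lemmas and local-homomorphism instances
(`Motives/AbelianVarietyLie`), `precompHom`. No `instance` is declared.

## References

* [GortzWedhorn2023] U. Görtz, T. Wedhorn, *Algebraic Geometry II* (2023): Rem. 27.1 (p. 799),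
  Prop. 27.15 (p. 805), Rem. 27.18 (3)–(4) and (27.4.6) (p. 806).
-/

universe u

open CategoryTheory AlgebraicGeometry
open scoped MonObj

noncomputable section

namespace Literature.AlgebraicGeometry.Motives

namespace AbelianVariety

open TrivSqZeroExt AlgPoints

variable {K : Type u} [Field K] {A : AbelianVariety K}

/-! ### Translating tangent vectors at the origin to an arbitrary point -/

section Translate

variable {L : Type u} [Field L] [Algebra K L]

variable (A L) in
/-- The `L[ε]`-points of `A` at the origin (`L`-valued tangent vectors at `e`): the kernel of
`A(L[ε]) → A(L)` (Görtz–Wedhorn II, Rem. 27.18 (4): `Lie(A)(L) = Ker(A(L[ε]) → A(L))`).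
[cite: GortzWedhorn2023, Rem. 27.18 (4) and (27.4.6)] -/
def tangentL : Subgroup (specOver K (DualNumber L) ⟶ A.X) :=
  (precompHom (A := A) (specOverMapOfAlgHom (augL K L))).ker

/-- Membership in `tangentL`. [cite: GortzWedhorn2020, Rem. 6.8] [cite: GortzWedhorn2023, Rem. 27.18 (3)–(4)] -/
theorem mem_tangentL_iff (t : specOver K (DualNumber L) ⟶ A.X) :
    t ∈ tangentL A L ↔ specOverMapOfAlgHom (augL K L) ≫ t = 1 :=
  MonoidHom.mem_ker

variable (x : A.X.left) (ξ : specOver K L ⟶ A.X) (hξ : basePt ξ = x)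

/-- The translate `ξ₀ · t` of a tangent vector `t` at the origin by the constant lift of `ξ` reduces
to `ξ`. [cite: GortzWedhorn2020, Rem. 6.8] [cite: GortzWedhorn2023, Rem. 27.18 (3)–(4)] -/
theorem aug_comp_liftPt_mul (t : specOver K (DualNumber L) ⟶ A.X) (ht : t ∈ tangentL A L) :
    specOverMapOfAlgHom (augL K L) ≫ (liftPt ξ * t) = ξ := by
  rw [MonObj.comp_mul, aug_comp_liftPt, (mem_tangentL_iff t).mp ht, mul_one]

/-- **The translated point derivation.** For an `L`-valued tangent vector `t` at the origin
(`t ∈ tangentL A L`) and an `L`-point `ξ` based at `x`, the point derivation at `x` of the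
translated point `ξ₀ · t` (`ξ₀` the constant lift of `ξ`; product in the group `A(L[ε])`): the value at
`ξ` of the left-invariant vector field defined by `t` (Görtz–Wedhorn II, Rem. 27.1 and Rem. 27.18
(4)). [cite: GortzWedhorn2023, Rem. 27.18 (4) and (27.4.6)] -/
def translatedDerivation (t : specOver K (DualNumber L) ⟶ A.X) (ht : t ∈ tangentL A L) :
    A.X.left.presheaf.stalk x →+ L :=
  pointDerivation x ξ hξ (liftPt ξ * t) (aug_comp_liftPt_mul ξ t ht)

/-- `translatedDerivation` does not depend on the presentation of the tangent vector. [cite: GortzWedhorn2020, Rem. 6.8] [cite: GortzWedhorn2023, Rem. 27.18 (3)–(4)] -/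
theorem translatedDerivation_congr {t t' : specOver K (DualNumber L) ⟶ A.X} (h : t = t')
    (ht : t ∈ tangentL A L) (ht' : t' ∈ tangentL A L) :
    translatedDerivation x ξ hξ t ht = translatedDerivation x ξ hξ t' ht' := by
  subst h; rfl

/-- The trivial tangent vector translates to the zero derivation. [cite: GortzWedhorn2020, Rem. 6.8] [cite: GortzWedhorn2023, Rem. 27.18 (3)–(4)] -/
theorem translatedDerivation_one :
    translatedDerivation x ξ hξ 1 (one_mem _) = 0 := by
  rw [translatedDerivation, pointDerivation_congr x ξ hξ (mul_one (liftPt ξ)) _ (aug_comp_liftPt ξ)]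
  exact pointDerivation_liftPt x ξ hξ

/-- **Injectivity of translation**: the translated derivation of `t` vanishes only for `t = 1`
(cancellation in the group `A(L[ε])`, and points with values in a local ring are determined by their
local homomorphism). [cite: GortzWedhorn2020, Rem. 6.8] [cite: GortzWedhorn2023, Rem. 27.18 (3)–(4)] -/
theorem translatedDerivation_eq_zero_iff (t : specOver K (DualNumber L) ⟶ A.X) (ht : t ∈ tangentL A L) :
    translatedDerivation x ξ hξ t ht = 0 ↔ t = 1 := by
  constructor
  · intro h
    have h1 : liftPt ξ * t = liftPt ξ := eq_liftPt_of_pointDerivation_eq_zero x ξ hξ _ _ h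
    exact mul_left_cancel (a := liftPt ξ) (by rw [h1, mul_one])
  · rintro rfl
    exact translatedDerivation_one x ξ hξ

/-! #### Homogeneity: `ε ↦ c ε` -/

variable (K) in
/-- The `L`-algebra endomorphism `a + b ε ↦ a + c b ε` of `L[ε]`, as a `K`-algebra map (it induces the
scalar multiplication by `c` on tangent vectors, Görtz–Wedhorn II, Rem. 27.18 (4)).
[cite: GortzWedhorn2023, Rem. 27.18 (4)] -/
def scaleEps (c : L) : DualNumber L →ₐ[K] DualNumber L :=
  (TrivSqZeroExt.map (c • LinearMap.id : L →ₗ[L] L)).restrictScalars K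

/-- `scaleEps c` fixes the constant part. [cite: GortzWedhorn2020, Rem. 6.8] [cite: GortzWedhorn2023, Rem. 27.18 (3)–(4)] -/
theorem fst_scaleEps (c : L) (z : DualNumber L) : (scaleEps K c z).fst = z.fst := fst_map _ z

/-- `scaleEps c` multiplies the `ε`-part by `c`. [cite: GortzWedhorn2020, Rem. 6.8] [cite: GortzWedhorn2023, Rem. 27.18 (3)–(4)] -/
theorem snd_scaleEps (c : L) (z : DualNumber L) : (scaleEps K c z).snd = c * z.snd := by
  change (TrivSqZeroExt.map (c • LinearMap.id : L →ₗ[L] L) z).snd = c * z.snd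
  rw [snd_map, LinearMap.smul_apply, LinearMap.id_apply, smul_eq_mul]

/-- `scaleEps c` is local. [cite: GortzWedhorn2020, Rem. 6.8] [cite: GortzWedhorn2023, Rem. 27.18 (3)–(4)] -/
theorem isLocalHom_scaleEps (c : L) : IsLocalHom (CommRingCat.ofHom (scaleEps K c).toRingHom).hom :=
  ⟨fun z hz => by
    rw [isUnit_iff_isUnit_fst] at hz ⊢
    rwa [CommRingCat.hom_ofHom, AlgHom.toRingHom_eq_coe, RingHom.coe_coe, fst_scaleEps] at hz⟩

/-- `aug ∘ scaleEps c = aug`. [cite: GortzWedhorn2020, Rem. 6.8] [cite: GortzWedhorn2023, Rem. 27.18 (3)–(4)] -/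
theorem augL_comp_scaleEps (c : L) : (augL K L).comp (scaleEps K c) = augL K L := by
  apply AlgHom.ext
  intro z
  exact fst_scaleEps (K := K) c z

/-- `scaleEps c ∘ incl = incl`. [cite: GortzWedhorn2020, Rem. 6.8] [cite: GortzWedhorn2023, Rem. 27.18 (3)–(4)] -/
theorem scaleEps_comp_inclL (c : L) : (scaleEps K c).comp (inclL K L) = inclL K L := by
  apply AlgHom.ext
  intro z
  change TrivSqZeroExt.map (c • LinearMap.id : L →ₗ[L] L) (inl z) = inl z
  exact map_inl _ z

/-- Scaling a tangent vector at the origin gives a tangent vector at the origin. [cite: GortzWedhorn2020, Rem. 6.8] [cite: GortzWedhorn2023, Rem. 27.18 (3)–(4)] -/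
theorem scale_mem_tangentL (c : L) {t : specOver K (DualNumber L) ⟶ A.X} (ht : t ∈ tangentL A L) :
    specOverMapOfAlgHom (scaleEps K c) ≫ t ∈ tangentL A L := by
  rw [mem_tangentL_iff, ← Category.assoc, specOverMapOfAlgHom_comp, augL_comp_scaleEps]
  exact (mem_tangentL_iff t).mp ht

/-- **Homogeneity**: scaling the tangent vector by `c` scales the translated derivation by `c`
(Görtz–Wedhorn II, Rem. 27.18 (4): `ε ↦ c ε` induces the scalar multiplication).
[cite: GortzWedhorn2023, Rem. 27.18 (4)] -/
theorem translatedDerivation_scale (c : L) (t : specOver K (DualNumber L) ⟶ A.X) (ht : t ∈ tangentL A L)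
    (a : A.X.left.presheaf.stalk x) :
    translatedDerivation x ξ hξ (specOverMapOfAlgHom (scaleEps K c) ≫ t) (scale_mem_tangentL c ht) a =
      c * translatedDerivation x ξ hξ t ht a := by
  have hlift : specOverMapOfAlgHom (scaleEps K c) ≫ liftPt ξ = liftPt ξ := by
    rw [liftPt, ← Category.assoc, specOverMapOfAlgHom_comp, scaleEps_comp_inclL]
  have hmul : specOverMapOfAlgHom (scaleEps K c) ≫ (liftPt ξ * t) =
      liftPt ξ * (specOverMapOfAlgHom (scaleEps K c) ≫ t) := by
    rw [MonObj.comp_mul, hlift]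
  have e := evDual_eq_comp x ξ hξ (liftPt ξ * t)
    (basePt_eq_of_aug_comp_eq' x ξ hξ (aug_comp_liftPt_mul ξ t ht)) (scaleEps K c)
    (isLocalHom_scaleEps c) (liftPt ξ * (specOverMapOfAlgHom (scaleEps K c) ≫ t))
    (aug_comp_liftPt_mul ξ _ (scale_mem_tangentL c ht)) hmul
  rw [translatedDerivation, translatedDerivation, pointDerivation_apply, pointDerivation_apply, e,
    CommRingCat.comp_apply]
  exact snd_scaleEps (K := K) c _

/-! #### Additivity: the `L[ε₁, ε₂]` argument (Görtz–Wedhorn II, Rem. 27.18 (3)) at the point `x` -/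

/-- **Additivity of translation** (Görtz–Wedhorn II, Rem. 27.18 (3), the argument `T_e(m) = +`
transported to the point `x`): the translated derivation of a product of tangent vectors is the sum of
the translated derivations. Proof: the `L[ε₁, ε₂]`-point `u = ξ₀₀ · incl₁^*(t₁) · incl₂^*(t₂)` has
`proj₁^* u = ξ₀ t₁`, `proj₂^* u = ξ₀ t₂`, `codiag^* u = ξ₀ t₁ t₂`, and the `ε`-part of `codiag` is the
sum of the two `ε`-parts. [cite: GortzWedhorn2023, Rem. 27.18 (3)] -/
theorem translatedDerivation_mul (t₁ t₂ : specOver K (DualNumber L) ⟶ A.X) (h₁ : t₁ ∈ tangentL A L)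
    (h₂ : t₂ ∈ tangentL A L) (a : A.X.left.presheaf.stalk x) :
    translatedDerivation x ξ hξ (t₁ * t₂) (mul_mem h₁ h₂) a =
      translatedDerivation x ξ hξ t₁ h₁ a + translatedDerivation x ξ hξ t₂ h₂ a := by
  -- the `K`-algebra maps between `L`, `L[ε]`, `L[ε₁, ε₂]`
  let p₁ : DualNumber₂ L →ₐ[K] DualNumber L := (DualNumber₂.proj₁ L).restrictScalars K
  let p₂ : DualNumber₂ L →ₐ[K] DualNumber L := (DualNumber₂.proj₂ L).restrictScalars K
  let cd : DualNumber₂ L →ₐ[K] DualNumber L := (DualNumber₂.codiag L).restrictScalars K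
  let i₁ : DualNumber L →ₐ[K] DualNumber₂ L := (DualNumber₂.incl₁ L).restrictScalars K
  let i₂ : DualNumber L →ₐ[K] DualNumber₂ L := (DualNumber₂.incl₂ L).restrictScalars K
  let ag : DualNumber₂ L →ₐ[K] L := (DualNumber₂.aug L).restrictScalars K
  let il : L →ₐ[K] DualNumber₂ L := (inlAlgHom L L (L × L)).restrictScalars K
  -- composition identities
  have hp₁i₁ : p₁.comp i₁ = AlgHom.id K _ := by
    apply AlgHom.ext; intro z; exact DFunLike.congr_fun (DualNumber₂.proj₁_comp_incl₁ L) z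
  have hp₂i₂ : p₂.comp i₂ = AlgHom.id K _ := by
    apply AlgHom.ext; intro z; exact DFunLike.congr_fun (DualNumber₂.proj₂_comp_incl₂ L) z
  have hcdi₁ : cd.comp i₁ = AlgHom.id K _ := by
    apply AlgHom.ext; intro z; exact DFunLike.congr_fun (DualNumber₂.codiag_comp_incl₁ L) z
  have hcdi₂ : cd.comp i₂ = AlgHom.id K _ := by
    apply AlgHom.ext; intro z; exact DFunLike.congr_fun (DualNumber₂.codiag_comp_incl₂ L) z
  have hp₁i₂ : p₁.comp i₂ = (inclL K L).comp (augL K L) := by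
    apply AlgHom.ext; intro z; exact DFunLike.congr_fun (DualNumber₂.proj₁_comp_incl₂ L) z
  have hp₂i₁ : p₂.comp i₁ = (inclL K L).comp (augL K L) := by
    apply AlgHom.ext; intro z; exact DFunLike.congr_fun (DualNumber₂.proj₂_comp_incl₁ L) z
  have hagi₁ : ag.comp i₁ = augL K L := by
    apply AlgHom.ext; intro z; exact DFunLike.congr_fun (DualNumber₂.aug_comp_incl₁ L) z
  have hagi₂ : ag.comp i₂ = augL K L := by
    apply AlgHom.ext; intro z; exact DFunLike.congr_fun (DualNumber₂.aug_comp_incl₂ L) z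
  have hp₁il : p₁.comp il = inclL K L := by apply AlgHom.ext; intro z; exact map_inl _ z
  have hp₂il : p₂.comp il = inclL K L := by apply AlgHom.ext; intro z; exact map_inl _ z
  have hcdil : cd.comp il = inclL K L := by apply AlgHom.ext; intro z; exact map_inl _ z
  have hagil : ag.comp il = AlgHom.id K L := by apply AlgHom.ext; intro z; rfl
  -- pull-backs of tangent vectors along constant maps are trivial
  have hkill : ∀ {t : specOver K (DualNumber L) ⟶ A.X}, t ∈ tangentL A L →
      specOverMapOfAlgHom ((inclL K L).comp (augL K L)) ≫ t = 1 := fun {t} ht => by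
    rw [← specOverMapOfAlgHom_comp, Category.assoc, (mem_tangentL_iff t).mp ht, MonObj.comp_one]
  -- the two-parameter point
  set u : specOver K (DualNumber₂ L) ⟶ A.X :=
    (specOverMapOfAlgHom il ≫ ξ) * (specOverMapOfAlgHom i₁ ≫ t₁) * (specOverMapOfAlgHom i₂ ≫ t₂) with hu
  have hu₁ : specOverMapOfAlgHom p₁ ≫ u = liftPt ξ * t₁ := by
    rw [hu, MonObj.comp_mul, MonObj.comp_mul, ← Category.assoc, ← Category.assoc, ← Category.assoc,
      specOverMapOfAlgHom_comp, specOverMapOfAlgHom_comp, specOverMapOfAlgHom_comp, hp₁il, hp₁i₁, hp₁i₂,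
      specOverMapOfAlgHom_id, Category.id_comp, hkill h₂, mul_one]
    rfl
  have hu₂ : specOverMapOfAlgHom p₂ ≫ u = liftPt ξ * t₂ := by
    rw [hu, MonObj.comp_mul, MonObj.comp_mul, ← Category.assoc, ← Category.assoc, ← Category.assoc,
      specOverMapOfAlgHom_comp, specOverMapOfAlgHom_comp, specOverMapOfAlgHom_comp, hp₂il, hp₂i₂, hp₂i₁,
      specOverMapOfAlgHom_id, Category.id_comp, hkill h₁, mul_one]
    rfl
  have hucd : specOverMapOfAlgHom cd ≫ u = liftPt ξ * (t₁ * t₂) := by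
    rw [hu, MonObj.comp_mul, MonObj.comp_mul, ← Category.assoc, ← Category.assoc, ← Category.assoc,
      specOverMapOfAlgHom_comp, specOverMapOfAlgHom_comp, specOverMapOfAlgHom_comp, hcdil, hcdi₁, hcdi₂,
      specOverMapOfAlgHom_id, Category.id_comp, Category.id_comp, mul_assoc]
    rfl
  have huag : specOverMapOfAlgHom ag ≫ u = ξ := by
    rw [hu, MonObj.comp_mul, MonObj.comp_mul, ← Category.assoc, ← Category.assoc, ← Category.assoc,
      specOverMapOfAlgHom_comp, specOverMapOfAlgHom_comp, specOverMapOfAlgHom_comp, hagil, hagi₁, hagi₂,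
      specOverMapOfAlgHom_id, Category.id_comp, (mem_tangentL_iff t₁).mp h₁,
      (mem_tangentL_iff t₂).mp h₂, mul_one, mul_one]
  have hubase : basePt u = x := by
    haveI : IsLocalHom (CommRingCat.ofHom ag.toRingHom).hom := ⟨fun _ hx => isUnit_iff_isUnit_fst.mpr hx⟩
    rw [← hξ, basePt, basePt, ← huag, Over.comp_left, Scheme.Hom.comp_apply, specOverMapOfAlgHom_left]
    congr 1
    exact (Spec_closedPoint (f := CommRingCat.ofHom ag.toRingHom)).symm
  -- local homomorphisms of the three images
  have hloc : ∀ (ψ : DualNumber₂ L →ₐ[L] DualNumber L), IsLocalHom ψ.toRingHom →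
      IsLocalHom (CommRingCat.ofHom (ψ.restrictScalars K).toRingHom).hom := fun ψ h => h
  have e₁ := evDual_eq_comp x ξ hξ u hubase p₁ (hloc _ (isLocalHom_proj₁ L)) _
    (aug_comp_liftPt_mul ξ t₁ h₁) hu₁
  have e₂ := evDual_eq_comp x ξ hξ u hubase p₂ (hloc _ (isLocalHom_proj₂ L)) _
    (aug_comp_liftPt_mul ξ t₂ h₂) hu₂
  have ecd := evDual_eq_comp x ξ hξ u hubase cd (hloc _ (isLocalHom_codiag L)) _
    (aug_comp_liftPt_mul ξ (t₁ * t₂) (mul_mem h₁ h₂)) hucd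
  rw [translatedDerivation, translatedDerivation, translatedDerivation, pointDerivation_apply,
    pointDerivation_apply, pointDerivation_apply, e₁, e₂, ecd]
  change ((DualNumber₂.codiag L) (evAtPt x u.left hubase a)).snd =
    ((DualNumber₂.proj₁ L) (evAtPt x u.left hubase a)).snd +
      ((DualNumber₂.proj₂ L) (evAtPt x u.left hubase a)).snd
  simp only [snd_map, LinearMap.add_apply, LinearMap.fst_apply, LinearMap.snd_apply]

end Translate

/-! ### Sums of scaled tangent vectors -/

section Sums

variable {L : Type u} [Field L] [Algebra K L]
variable (x : A.X.left) (ξ : specOver K L ⟶ A.X) (hξ : basePt ξ = x)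

/-- The tangent vector `∏ i ∈ s, (g i) · t i` (product in `A(L[ε])` of the scaled vectors) lies at the
origin. [cite: GortzWedhorn2020, Rem. 6.8] [cite: GortzWedhorn2023, Rem. 27.18 (3)–(4)] -/
theorem prod_scale_mem_tangentL {J : Type*} (s : Finset J) (g : J → L)
    (t : J → (specOver K (DualNumber L) ⟶ A.X)) (ht : ∀ i, t i ∈ tangentL A L) :
    (∏ i ∈ s, specOverMapOfAlgHom (scaleEps K (g i)) ≫ t i) ∈ tangentL A L :=
  prod_mem fun i _ => scale_mem_tangentL (g i) (ht i)

/-- **Linearity of translation**: the translated derivation of `∏ i ∈ s, (g i) · t i` is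
`∑ i ∈ s, g i · ∂(t i)` (additivity and homogeneity, Görtz–Wedhorn II, Rem. 27.18 (3)–(4)).
[cite: GortzWedhorn2023, Rem. 27.18 (3)–(4)] -/
theorem translatedDerivation_prod_scale {J : Type*} (s : Finset J) (g : J → L)
    (t : J → (specOver K (DualNumber L) ⟶ A.X)) (ht : ∀ i, t i ∈ tangentL A L)
    (a : A.X.left.presheaf.stalk x) :
    translatedDerivation x ξ hξ (∏ i ∈ s, specOverMapOfAlgHom (scaleEps K (g i)) ≫ t i)
        (prod_scale_mem_tangentL s g t ht) a =
      ∑ i ∈ s, g i * translatedDerivation x ξ hξ (t i) (ht i) a := by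
  classical
  induction s using Finset.induction_on with
  | empty =>
    rw [Finset.sum_empty, translatedDerivation_congr x ξ hξ Finset.prod_empty _ (one_mem _),
      translatedDerivation_one, AddMonoidHom.zero_apply]
  | insert i s hi ih =>
    have hins : (∏ j ∈ insert i s, specOverMapOfAlgHom (scaleEps K (g j)) ≫ t j) =
        (specOverMapOfAlgHom (scaleEps K (g i)) ≫ t i) *
          ∏ j ∈ s, specOverMapOfAlgHom (scaleEps K (g j)) ≫ t j := Finset.prod_insert hi
    have step := translatedDerivation_congr x ξ hξ hins (prod_scale_mem_tangentL _ g t ht)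
      (mul_mem (scale_mem_tangentL (g i) (ht i)) (prod_scale_mem_tangentL s g t ht))
    rw [Finset.sum_insert hi, step, translatedDerivation_mul x ξ hξ _ _
      (scale_mem_tangentL (g i) (ht i)) (prod_scale_mem_tangentL s g t ht) a,
      translatedDerivation_scale x ξ hξ (g i) (t i) (ht i) a, ih]

end Sums

end AbelianVariety

end Literature.AlgebraicGeometry.Motives

end
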